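import Mathlib.Probability.Distributions.Gaussian.Real
import Mathlib.Probability.CDF
import Mathlib.Topology.EMetricSpace.Lipschitz
import HarnessLib

/-!
# Metric flows (Bamler 2023, §3.1, Def. 3.2) — the synthetic notion of a (super) Ricci flow

R. Bamler, *Compactness theory of the space of super Ricci flows*, Invent. Math. 233 (2023),
§3.1, Definition 3.2 (metric flow): "Let `I ⊂ ℝ` be a subset. A metric flow (over `I`) is a tuple
`(𝒳, 𝔱, (d_t)_{t ∈ I}, (ν_{x;s})_{x ∈ 𝒳, s ∈ I, s ≤ 𝔱(x)})` with the following properties: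
(1) `𝒳` is a set consisting of points. (2) `𝔱 : 𝒳 → I` is a map called time-function. Its level
sets `𝒳_t := 𝔱⁻¹(t)` are called time-slices … (3) `(𝒳_t, d_t)` is a complete and separable metric
space for all `t ∈ I`. (4) `ν_{x;s} ∈ 𝒫(𝒳_s)` for all `x ∈ 𝒳`, `s ∈ I`, `s ≤ 𝔱(x)`. For any `x ∈ 𝒳`
the family `(ν_{x;s})_{s ∈ I, s ≤ 𝔱(x)}` is called the conjugate heat kernel at `x`.
(5) `ν_{x;𝔱(x)} = δ_x` for all `x ∈ 𝒳`. (6) For all `s, t ∈ I`, `s < t`, `T ≥ 0` and any measurable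
function `u_s : 𝒳_s → [0, 1]` with the property that if `T > 0`, then `u_s = Φ ∘ f_s` for some
`T^{-1/2}`-Lipschitz function `f_s : 𝒳_s → ℝ` (if `T = 0`, then there is no additional assumption
on `u_s`), the following is true. The function `u_t : 𝒳_t → ℝ`, `x ↦ ∫_{𝒳_s} u_s dν_{x;s}` is either
constant or of the form `u_t = Φ ∘ f_t`, where `f_t : 𝒳_t → ℝ` is `(t − s + T)^{-1/2}`-Lipschitz.
(7) For any `t₁ ≤ t₂ ≤ t₃` in `I`, `x ∈ 𝒳_{t₃}` we have the reproduction formula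
`ν_{x;t₁} = ∫_{𝒳_{t₂}} ν_{·;t₁} dν_{x;t₂}`, meaning that for any Borel set `S ⊂ 𝒳_{t₁}`,
`ν_{x;t₁}(S) = ∫_{𝒳_{t₂}} ν_{y;t₁}(S) dν_{x;t₂}(y)`." Here (§3, (3.1)) `Φ : ℝ → (0, 1)` is the
antiderivative of `(4π)^{-1/2} e^{-x²/4}` with `Φ(−∞) = 0`, `Φ(∞) = 1`.

This file vendors the DEFINITIONS (real definitions with bodies, no named facts):

* `MetricFlow.Phi` — Bamler's `Φ`, defined as the cumulative distribution function of the centred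
  Gaussian of variance `2` (whose density is `(4π)^{-1/2} e^{-x²/4}`; `MetricFlow.Phi_eq_integral`),
  with `Φ` monotone, `0 ≤ Φ ≤ 1`, `Φ → 0, 1` at `∓∞` from Mathlib's `ProbabilityTheory.cdf`;
* `MetricFlow I` — **Def. 3.2**. Design: a metric flow is GIVEN by its family of time-slices
  `Slice : I → Type` (so the set of points is `Σ t, Slice t`, `MetricFlow.Pt`, and the time-function
  is the first projection, `MetricFlow.timeFn`, items (1)–(2)); each slice carries complete separable
  metric and Borel measurable structures (item (3), instance-valued fields); the conjugate heat
  kernels are measures `condKernel x s` on `Slice s` for `x : Slice t` (all `s`, meaningful and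
  constrained only for `s ≤ t`, item (4): probability measures), with (5) `condKernel x t = δ_x`,
  (6) the gradient property verbatim (Lipschitz constants as `ℝ≥0` via `Real.toNNReal (1/√T)`), and
  (7) the reproduction formula for measurable sets, the integral being the lower Lebesgue integral
  (no measurability of `y ↦ ν_{y;t₁}(S)` is presupposed; in print it follows from (5), (6));
* `MetricFlow.restrict` — **restriction to `I' ⊆ I`** (§3.1, Definition following Def. 3.2:
  "the restriction of `𝒳` to `I'` is `(𝒳_{I'}, 𝔱|, (d_t)_{t ∈ I'}, (ν_{x;s})_{x ∈ 𝒳_{I'}, s ∈ I', s ≤ 𝔱(x)})`");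
* `MetricFlow.IsHeatFlow`, `MetricFlow.IsConjugateHeatFlow` — **§3.2, Definitions (heat flow),
  (conjugate heat flow)**: `u_t(x) = ∫_{𝒳_s} u_s dν_{x;s}` for `s ≤ t` in `I'`, resp.
  `μ_s = ∫_{𝒳_t} ν_{x;s} dμ_t(x)` for `s ≤ t` in `I'`;
* `MetricFlow.point I` — the metric flow all of whose time-slices are one point (non-vacuity of
  the definition: (6) holds with `u_t` constant, (7) by `∫ dδ`).

What is NOT here: the metric flow of a smooth (super) Ricci flow on a compact manifold (§3.6 of the
source: needs the conjugate heat kernel of a Ricci flow, not in the tree), `H`-concentration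
(Def. 3.30), the natural topology (§3.5), future completion (§4.4), `𝔽`-distance and the
compactness theorem (§§5–7). These are the vocabulary behind the named fact
`bamler_orbifoldTangentFlowAtInfinity_four` (`BamlerTangentFlowAtInfinity.lean`).
-- TODO(general form): existence/uniqueness of (conjugate) heat flows from bounded measurable
-- initial / probability final data (§3.2, the two Propositions after the definitions: "follows
-- using the reproduction formula"), and the parabolic rescaling lemma of §3.1.

## References

* R. H. Bamler, *Compactness theory of the space of super Ricci flows*, Invent. Math. 233 (2023),
  1121–1277 (arXiv:2008.09298), §3, (3.1) (`Φ`); §3.1, Def. 3.2 (metric flow), the remarks and the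
  Definition (restriction) following it; §3.2, Definitions (heat flow), (conjugate heat flow).
  [Bamler2023]
-/

noncomputable section

open Set MeasureTheory ProbabilityTheory Filter
open scoped Topology ENNReal NNReal

namespace Literature.Geometry.Riemannian

universe u

/-! ### Bamler's `Φ` -/

/-- **Bamler's `Φ : ℝ → (0, 1)`** (2023, §3, (3.1)): the antiderivative of `(4π)^{-1/2} e^{-x²/4}`
with `lim_{-∞} Φ = 0`, `lim_{+∞} Φ = 1` ("`(x, t) ↦ Φ(t^{-1/2} x)` is a solution to the
1-dimensional heat equation with initial condition `χ_{[0,∞)}`"). Defined as the cumulative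
distribution function (`ProbabilityTheory.cdf`) of the centred Gaussian of variance `2`, whose
density is exactly `(4π)^{-1/2} e^{-x²/4}` (`Phi_eq_integral`). [cite: Bamler2023, §3, (3.1)] -/
def MetricFlow.Phi (x : ℝ) : ℝ :=
  cdf (gaussianReal 0 2) x

namespace MetricFlow

/-- `Φ(x) = ∫_{-∞}^x (4π)^{-1/2} e^{-y²/4} dy` (Bamler 2023, (3.1)). [cite: Bamler2023, §3, (3.1)] -/
theorem Phi_eq_integral (x : ℝ) :
    Phi x = ∫ y in Iic x, (Real.sqrt (4 * Real.pi))⁻¹ * Real.exp (-y ^ 2 / 4) := by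
  have hpdf : ∀ y, gaussianPDFReal 0 2 y = (Real.sqrt (4 * Real.pi))⁻¹ * Real.exp (-y ^ 2 / 4) := by
    intro y
    rw [gaussianPDFReal]
    push_cast
    rw [show (2 : ℝ) * Real.pi * 2 = 4 * Real.pi by ring,
      show -(y - 0) ^ 2 / (2 * 2) = -y ^ 2 / 4 by ring]
  rw [Phi, cdf_eq_real, measureReal_def, gaussianReal_apply_eq_integral _ two_ne_zero,
    ENNReal.toReal_ofReal (integral_nonneg fun y ↦ gaussianPDFReal_nonneg _ _ y)]
  exact integral_congr_ae (Eventually.of_forall hpdf)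

/-- `Φ` is non-decreasing. [cite: Bamler2023, §3, (3.1)] -/
theorem Phi_mono : Monotone Phi := fun _ _ h ↦ monotone_cdf _ h

/-- `0 ≤ Φ ≤ 1`. [cite: Bamler2023, §3, (3.1)] -/
theorem Phi_mem_Icc (x : ℝ) : Phi x ∈ Icc (0 : ℝ) 1 := ⟨cdf_nonneg _ x, cdf_le_one _ x⟩

/-- `Φ(x) → 0` as `x → −∞`. [cite: Bamler2023, §3, (3.1)] -/
theorem tendsto_Phi_atBot : Tendsto Phi atBot (𝓝 0) := tendsto_cdf_atBot _

/-- `Φ(x) → 1` as `x → +∞`. [cite: Bamler2023, §3, (3.1)] -/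
theorem tendsto_Phi_atTop : Tendsto Phi atTop (𝓝 1) := tendsto_cdf_atTop _

end MetricFlow

/-! ### Definition 3.2 -/

/-- **Metric flow over `I ⊆ ℝ`** (Bamler 2023, §3.1, Def. 3.2), given by its time-slices: for
`t ∈ I` a type `Slice t` (so that the set of points of item (1) is `Σ t, Slice t` and the
time-function of item (2) is the first projection, `MetricFlow.Pt`, `MetricFlow.timeFn`), each a
complete separable metric space (item (3)) with its Borel σ-algebra; the **conjugate heat kernel**
at `x ∈ 𝒳_t` is the family of measures `condKernel x s` on `𝒳_s` — probability measures for
`s ≤ t` (item (4); for `s > t` the field is not constrained and never used), with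
(5) `condKernel x t = δ_x`; (6) the **gradient property**: for `s < t` in `I`, `T ≥ 0` and a
measurable `u : 𝒳_s → [0, 1]` which, if `T > 0`, is `Φ ∘ f` for a `T^{-1/2}`-Lipschitz `f`, the
function `x ↦ ∫_{𝒳_s} u dν_{x;s}` on `𝒳_t` is constant or equals `Φ ∘ f'` for a
`(t − s + T)^{-1/2}`-Lipschitz `f'`; (7) the **reproduction formula**
`ν_{x;t₁}(S) = ∫_{𝒳_{t₂}} ν_{y;t₁}(S) dν_{x;t₂}(y)` for `t₁ ≤ t₂ ≤ t₃` in `I`, `x ∈ 𝒳_{t₃}` and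
measurable `S ⊆ 𝒳_{t₁}` (lower Lebesgue integral). The time-slices need not be length spaces and
`I` need not be an interval (Remarks after Def. 3.2). [cite: Bamler2023, §3.1, Def. 3.2 (metric flow)] -/
structure MetricFlow (I : Set ℝ) : Type (u + 1) where
  /-- The time-slice `𝒳_t`, `t ∈ I`. -/
  Slice : I → Type u
  /-- Each time-slice is a metric space … -/
  [instMetricSpace : ∀ t, MetricSpace (Slice t)]
  /-- … complete … -/
  [instCompleteSpace : ∀ t, CompleteSpace (Slice t)]
  /-- … and separable, -/
  [instSeparableSpace : ∀ t, TopologicalSpace.SeparableSpace (Slice t)]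
  /-- with a σ-algebra … -/
  [instMeasurableSpace : ∀ t, MeasurableSpace (Slice t)]
  /-- … which is the Borel σ-algebra of `d_t`. -/
  [instBorelSpace : ∀ t, BorelSpace (Slice t)]
  /-- The conjugate heat kernel `ν_{x;s}` at `x ∈ 𝒳_t`, a measure on `𝒳_s` (used for `s ≤ t`). -/
  condKernel : ∀ {t : I}, Slice t → (s : I) → Measure (Slice s)
  /-- (4) `ν_{x;s}` is a probability measure for `s ≤ t = 𝔱(x)`. -/
  isProbabilityMeasure_condKernel :
    ∀ {t : I} (x : Slice t) {s : I}, (s : ℝ) ≤ t → IsProbabilityMeasure (condKernel x s)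
  /-- (5) `ν_{x;𝔱(x)} = δ_x`. -/
  condKernel_self : ∀ {t : I} (x : Slice t), condKernel x t = Measure.dirac x
  /-- (6) the gradient property of heat flows of `Φ ∘ (Lipschitz)` initial data. -/
  gradient_property :
    ∀ {s t : I}, (s : ℝ) < t → ∀ (T : ℝ), 0 ≤ T → ∀ (u : Slice s → ℝ), Measurable u →
      (∀ y, u y ∈ Icc (0 : ℝ) 1) →
      (0 < T → ∃ f : Slice s → ℝ,
        LipschitzWith (Real.toNNReal (1 / Real.sqrt T)) f ∧ u = MetricFlow.Phi ∘ f) →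
      (∃ c : ℝ, ∀ x : Slice t, ∫ y, u y ∂(condKernel x s) = c) ∨
        ∃ f' : Slice t → ℝ, LipschitzWith (Real.toNNReal (1 / Real.sqrt ((t : ℝ) - s + T))) f' ∧
          ∀ x : Slice t, ∫ y, u y ∂(condKernel x s) = MetricFlow.Phi (f' x)
  /-- (7) the reproduction formula `ν_{x;t₁}(S) = ∫ ν_{y;t₁}(S) dν_{x;t₂}(y)`, `t₁ ≤ t₂ ≤ t₃`. -/
  reproduction :
    ∀ {t₁ t₂ t₃ : I}, (t₁ : ℝ) ≤ t₂ → (t₂ : ℝ) ≤ t₃ → ∀ (x : Slice t₃) (S : Set (Slice t₁)),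
      MeasurableSet S → condKernel x t₁ S = ∫⁻ y, condKernel y t₁ S ∂(condKernel x t₂)

namespace MetricFlow

attribute [instance] MetricFlow.instMetricSpace MetricFlow.instCompleteSpace
  MetricFlow.instSeparableSpace MetricFlow.instMeasurableSpace MetricFlow.instBorelSpace

variable {I : Set ℝ}

/-- Item (4) as an instance: `ν_{x;s}` is a probability measure for `s ≤ 𝔱(x)`, usable as
`haveI := 𝒳.isProbabilityMeasure hst x`. [cite: Bamler2023, §3.1, Def. 3.2 (metric flow)] -/
theorem isProbabilityMeasure (𝒳 : MetricFlow I) {s t : I} (hst : (s : ℝ) ≤ t) (x : 𝒳.Slice t) :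
    IsProbabilityMeasure (𝒳.condKernel x s) :=
  𝒳.isProbabilityMeasure_condKernel x hst

/-- **The points of a metric flow** (item (1) of Def. 3.2): `𝒳 = ⨆_{t ∈ I} 𝒳_t`, here the
Σ-type of the time-slices. [cite: Bamler2023, §3.1, Def. 3.2 (metric flow)] -/
def Pt (𝒳 : MetricFlow I) : Type u :=
  Σ t : I, 𝒳.Slice t

/-- **The time-function** `𝔱 : 𝒳 → I` (item (2) of Def. 3.2): the first projection; its level
sets are the time-slices. [cite: Bamler2023, §3.1, Def. 3.2 (metric flow)] -/
def timeFn (𝒳 : MetricFlow I) (x : 𝒳.Pt) : I :=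
  x.1

/-- The time-slice through a point `x` is `Slice (𝔱 x)` and `x` lies in it (tautology of the
Σ-encoding of items (1)–(2)). [cite: Bamler2023, §3.1, Def. 3.2 (metric flow)] -/
theorem timeFn_mk (𝒳 : MetricFlow I) (t : I) (x : 𝒳.Slice t) : 𝒳.timeFn ⟨t, x⟩ = t := rfl

/-- **The conjugate heat kernel at a point** `x ∈ 𝒳` as a family indexed by `s ∈ I`
(item (4): "For any `x ∈ 𝒳` the family `(ν_{x;s})_{s ∈ I, s ≤ 𝔱(x)}` is called the conjugate heat
kernel at `x`"). [cite: Bamler2023, §3.1, Def. 3.2 (metric flow)] -/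
def conjugateHeatKernelAt (𝒳 : MetricFlow I) (x : 𝒳.Pt) (s : I) : Measure (𝒳.Slice s) :=
  𝒳.condKernel x.2 s

/-- **Restriction of a metric flow to `I' ⊆ I`** (Bamler 2023, §3.1, the Definition following
Def. 3.2: "the restriction of `𝒳` to `I'` is given by
`(𝒳_{I'}, 𝔱|_{𝒳_{I'}}, (d_t)_{t ∈ I'}, (ν_{x;s})_{x ∈ 𝒳_{I'}, s ∈ I', s ≤ 𝔱(x)})`"; "it allows us to
restrict metric flows defined over intervals `I ⊂ ℝ` to smaller subsets `I' ⊂ I`"): the same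
slices, metrics and kernels over the smaller index set. [cite: Bamler2023, §3.1, Definition (restriction of a metric flow)] -/
def restrict (𝒳 : MetricFlow I) {I' : Set ℝ} (h : I' ⊆ I) : MetricFlow I' where
  Slice t := 𝒳.Slice ⟨t, h t.2⟩
  condKernel x s := 𝒳.condKernel x ⟨s, h s.2⟩
  isProbabilityMeasure_condKernel x _ hst := 𝒳.isProbabilityMeasure_condKernel x hst
  condKernel_self x := 𝒳.condKernel_self x
  gradient_property hst T hT u hu h01 hLip := 𝒳.gradient_property hst T hT u hu h01 hLip
  reproduction h12 h23 x S hS := 𝒳.reproduction h12 h23 x S hS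

/-- The slices of the restriction are the original slices. [cite: Bamler2023, §3.1, Definition (restriction of a metric flow)] -/
theorem restrict_Slice (𝒳 : MetricFlow I) {I' : Set ℝ} (h : I' ⊆ I) (t : I') :
    (𝒳.restrict h).Slice t = 𝒳.Slice ⟨t, h t.2⟩ := rfl

/-! ### §3.2: heat flows and conjugate heat flows -/

/-- **Heat flow** on the time-slab over `I' ⊆ I` (Bamler 2023, §3.2, Definition (heat flow)): a
family `(u_t : 𝒳_t → ℝ)_{t ∈ I'}` such that for all `x ∈ 𝒳_t`, `s ∈ I'`, `s ≤ t` (`t ∈ I'`), `u_s` is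
`ν_{x;s}`-integrable and `u_t(x) = ∫_{𝒳_s} u_s dν_{x;s}`. [cite: Bamler2023, §3.2, Definition (heat flow)] -/
def IsHeatFlow (𝒳 : MetricFlow I) (I' : Set ℝ) (u : ∀ t : I, 𝒳.Slice t → ℝ) : Prop :=
  ∀ ⦃s t : I⦄, (s : ℝ) ∈ I' → (t : ℝ) ∈ I' → (s : ℝ) ≤ t → ∀ x : 𝒳.Slice t,
    Integrable (u s) (𝒳.condKernel x s) ∧ u t x = ∫ y, u s y ∂(𝒳.condKernel x s)

/-- **Conjugate heat flow** over `I' ⊆ I` (Bamler 2023, §3.2, Definition (conjugate heat flow)):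
a family of probability measures `(μ_t ∈ 𝒫(𝒳_t))_{t ∈ I'}` with
`μ_s = ∫_{𝒳_t} ν_{x;s} dμ_t(x)` for all `s ≤ t` in `I'` (tested on measurable sets, lower Lebesgue
integral, as in the reproduction formula). [cite: Bamler2023, §3.2, Definition (conjugate heat flow)] -/
def IsConjugateHeatFlow (𝒳 : MetricFlow I) (I' : Set ℝ) (μ : ∀ t : I, Measure (𝒳.Slice t)) : Prop :=
  (∀ t : I, (t : ℝ) ∈ I' → IsProbabilityMeasure (μ t)) ∧
    ∀ ⦃s t : I⦄, (s : ℝ) ∈ I' → (t : ℝ) ∈ I' → (s : ℝ) ≤ t → ∀ S : Set (𝒳.Slice s),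
      MeasurableSet S → μ s S = ∫⁻ x, 𝒳.condKernel x s S ∂(μ t)

/-- **The conjugate heat kernel of a point is a conjugate heat flow** on `I ∩ (−∞, 𝔱(x)]`
(immediate from the reproduction formula (7) and item (4)). [cite: Bamler2023, §3.2, Definition (conjugate heat flow)] -/
theorem isConjugateHeatFlow_condKernel (𝒳 : MetricFlow I) {t₀ : I} (x : 𝒳.Slice t₀) :
    𝒳.IsConjugateHeatFlow (I ∩ Iic (t₀ : ℝ)) (fun s ↦ 𝒳.condKernel x s) := by
  refine ⟨fun t ht ↦ 𝒳.isProbabilityMeasure_condKernel x ht.2, ?_⟩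
  intro s t _ ht hst S hS
  exact 𝒳.reproduction hst ht.2 x S hS

/-! ### Non-vacuity: the one-point metric flow -/

/-- **The metric flow of a point**: every time-slice is the one-point space, every conjugate heat
kernel is the Dirac mass. Items (1)–(7) of Def. 3.2 hold trivially ((6): `u_t` is constant;
(7): `∫ c dδ = c`). Recorded to witness that the definition is inhabited. [folklore] -/
def point (I : Set ℝ) : MetricFlow.{0} I where
  Slice _ := PUnit
  condKernel _ _ := Measure.dirac PUnit.unit
  isProbabilityMeasure_condKernel _ _ _ := Measure.dirac.isProbabilityMeasure
  condKernel_self x := by cases x; rfl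
  gradient_property _ _ _ u _ _ _ := Or.inl ⟨∫ y, u y ∂(Measure.dirac PUnit.unit), fun _ ↦ rfl⟩
  reproduction _ _ x S _ := by
    rw [lintegral_dirac]

/-- Metric flows over any `I` exist (the one-point flow `MetricFlow.point`). [folklore] -/
instance (I : Set ℝ) : Inhabited (MetricFlow.{0} I) := ⟨point I⟩

end MetricFlow

end Literature.Geometry.Riemannian

end
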